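import Literature.MathematicalPhysics.QuantumFieldTheory.LatticeMassGap
import HarnessLib

/-!
# Euclidean clustering ⇔ Hamiltonian gap — proofs layer over `LatticeMassGap.lean`

This file discharges the two **constructive-qft.S10** named facts of `LatticeMassGap.lean`:

* `timeClustering_iff_massGap` (abstract form): for an Osterwalder–Schrader realisation
  `(H, ι, D)` of a measure `μ` (transfer operator `T = D.T ≥ 0`, vacuum `Ω = D.vacuum`),
  exponential clustering in the time direction with rate `m > 0` (`HasTimeClustering`) is
  equivalent to the mass gap `‖T P_{Ω^⊥}‖ ≤ e^{-m}` (`TransferData.HasMassGap`);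
* `latticeClustering_iff_gap` (lattice form on `ℤ^d`, link reflection `x₀ ↦ -1 - x₀`, unit time
  shift, positive-time cylinder σ-algebra), which is literally the abstract fact applied to the
  lattice data — this restores the interim proof preserved as a comment in `LatticeMassGap.lean`,
  now fed the discharged abstract fact.

## The printed argument and its formalisation

Sources: J. Glimm, A. Jaffe, *Quantum Physics* (2nd ed., 1987), §6.1, Thm. 6.1.3 (reconstruction
of `e^{-tH}` from a reflection-positive measure; property (iii) of its proof is the iterated
Schwarz inequality used below) and §19.7, Thm. 19.7.1 with the Remark following it (clustering of
`⟨(θA)^∧, e^{-tH} B^∧⟩ - ⟨(θA)^∧, Ω⟩⟨Ω, B^∧⟩` versus the spectrum of `H` at `0`);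
K. Osterwalder, E. Seiler, Ann. Phys. **110** (1978) 440–471, §2 (the lattice transfer matrix
between the hyperplanes `x₀ = -1` and `x₀ = 0`); E. Seiler, LNP 159 (1982), Ch. 2.

* `⇐` (gap ⇒ clustering) is the prelude theorem
  `IsOSRealisation.hasTimeClustering_of_hasMassGap_holds`
  (`|⟪ι F, T^t ι G⟫ - ⟪ι F, Ω⟫⟪Ω, ι G⟫| ≤ ‖ι F‖ ‖ι G‖ ‖T P_{Ω^⊥}‖^t`).
* `⇒` (clustering ⇒ gap). Under the realisation the clustered quantity for `F = G` is
  `⟪ι F, T^t ι F⟫ - ⟪ι F, Ω⟫⟪Ω, ι F⟫ = ⟪w, T^t w⟫` with `w = P_{Ω^⊥} ι F`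
  (`T` is symmetric and fixes `Ω`, so it commutes with `P_{Ω^⊥}`). Hence `|⟪w, T^t w⟫| ≤ C_w e^{-mt}`
  on the dense subset `P_{Ω^⊥} (ι 𝓔₊^∞)` of `Ω^⊥`. The **iterated Schwarz inequality** of
  Glimm–Jaffe's proof of Thm. 6.1.3 (iii) — `‖T^n w‖² = ⟪w, T^{2n} w⟩ ≤ ‖w‖ ‖T^{2n} w‖`, iterated
  along `n = 1, 2, 4, …, 2^k` — gives `‖T w‖^{2^k} ‖w‖ ≤ ‖T^{2^k} w‖ ‖w‖^{2^k}` and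
  `‖T^{2^k} w‖² = ⟨w, T^{2^{k+1}} w⟩ ≤ C_w e^{-m 2^{k+1}}`, so `(‖T w‖ / (e^{-m} ‖w‖))^{2^{k+1}} ≤ C_w / ‖w‖²`
  for all `k`, forcing `‖T w‖ ≤ e^{-m} ‖w‖` (`norm_apply_le_of_inner_pow_le`). This closed
  condition passes to the closure `Ω^⊥`, and `‖T P_{Ω^⊥} x‖ ≤ e^{-m} ‖P_{Ω^⊥} x‖ ≤ e^{-m} ‖x‖`
  is the gap-norm bound (`gapNorm_le_exp_of_dense_clustering`). No spectral theorem is needed.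

Nothing here is new mathematics; no new definitions or named facts are introduced.
-/

open MeasureTheory
open scoped InnerProductSpace

namespace Literature.MathematicalPhysics.QuantumFieldTheory

open Literature.Probability.LatticeModels

/-! ### The iterated Schwarz inequality -/

section IteratedSchwarz

variable {H : Type*} [NormedAddCommGroup H] [InnerProductSpace ℂ H]

/-- Powers of a symmetric bounded operator are symmetric: `⟪T^n x, y⟫ = ⟪x, T^n y⟫`
(Glimm–Jaffe 1987, §6.1, proof of Thm. 6.1.3, property (ii): `R(t)` is hermitian). [cite: GlimmJaffe1987, §6.1 Thm. 6.1.3 (ii)] -/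
theorem inner_pow_apply_left_eq_right {T : H →L[ℂ] H}
    (hT : ∀ x y : H, ⟪T x, y⟫_ℂ = ⟪x, T y⟫_ℂ) (n : ℕ) (x y : H) :
    ⟪(T ^ n) x, y⟫_ℂ = ⟪x, (T ^ n) y⟫_ℂ := by
  induction n generalizing x y with
  | zero => simp
  | succ n ih =>
    calc ⟪(T ^ (n + 1)) x, y⟫_ℂ = ⟪T ((T ^ n) x), y⟫_ℂ := by rw [pow_succ', mul_apply_eq_comp]
      _ = ⟪x, (T ^ n) (T y)⟫_ℂ := by rw [hT, ih]
      _ = ⟪x, (T ^ (n + 1)) y⟫_ℂ := by rw [pow_succ, mul_apply_eq_comp]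

/-- **Iterated Schwarz inequality** (Glimm–Jaffe 1987, §6.1, proof of Thm. 6.1.3, property
(iii)): if `T` is a symmetric bounded operator, `r > 0`, and the diagonal matrix elements of the
powers of `T` at `w` decay like `|⟪w, T^t w⟫| ≤ C r^t` for all `t : ℕ`, then `‖T w‖ ≤ r ‖w‖`.
Proof: `‖T^n w‖² = ⟪w, T^{2n} w⟫ ≤ ‖T^{2n} w‖ ‖w‖`, whence after `k` doublings
`‖T w‖^{2^k} ‖w‖ ≤ ‖T^{2^k} w‖ ‖w‖^{2^k}` and `‖T^{2^k} w‖² ≤ C r^{2^{k+1}}`; if `‖T w‖ > r ‖w‖`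
the ratio `(‖T w‖ / (r ‖w‖))^{2^{k+1}} ≤ C / ‖w‖²` would be bounded, a contradiction. [cite: GlimmJaffe1987, §6.1 Thm. 6.1.3 (iii)] -/
theorem norm_apply_le_of_inner_pow_le {T : H →L[ℂ] H}
    (hT : ∀ x y : H, ⟪T x, y⟫_ℂ = ⟪x, T y⟫_ℂ) {w : H} {C r : ℝ} (hr : 0 < r)
    (hC : ∀ t : ℕ, ‖⟪w, (T ^ t) w⟫_ℂ‖ ≤ C * r ^ t) : ‖T w‖ ≤ r * ‖w‖ := by
  -- the norms `b n = ‖T^n w‖`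
  obtain ⟨b, hb⟩ : ∃ b : ℕ → ℝ, ∀ n, b n = ‖(T ^ n) w‖ := ⟨fun n => ‖(T ^ n) w‖, fun _ => rfl⟩
  have hb0 : ∀ n, 0 ≤ b n := fun n => by rw [hb]; exact norm_nonneg _
  -- `b n ^ 2 = re ⟪w, T^(2n) w⟫` (symmetry of `T^n`)
  have hsq : ∀ n, b n ^ 2 = RCLike.re ⟪w, (T ^ (2 * n)) w⟫_ℂ := fun n => by
    rw [hb, two_mul, pow_add, mul_apply_eq_comp, ← inner_pow_apply_left_eq_right hT,
      inner_self_eq_norm_sq]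
  -- Schwarz: `b n ^ 2 ≤ b (2n) ‖w‖`
  have key1 : ∀ n, b n ^ 2 ≤ b (2 * n) * ‖w‖ := fun n => by
    rw [hsq, ← inner_pow_apply_left_eq_right hT, hb]
    exact (RCLike.re_le_norm _).trans (norm_inner_le_norm _ _)
  -- decay hypothesis: `b n ^ 2 ≤ C r^(2n)`
  have key2 : ∀ n, b n ^ 2 ≤ C * r ^ (2 * n) := fun n => by
    rw [hsq]
    exact (RCLike.re_le_norm _).trans (hC _)
  -- the case `w = 0` is trivial
  rcases eq_or_ne w 0 with hw | hw
  · simp [hw]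
  have hw0 : 0 < ‖w‖ := norm_pos_iff.mpr hw
  -- one doubling step: from exponent `N` to exponent `2N`
  have step : ∀ N : ℕ, b 1 ^ N * ‖w‖ ≤ b N * ‖w‖ ^ N →
      b 1 ^ (2 * N) * ‖w‖ ≤ b (2 * N) * ‖w‖ ^ (2 * N) := by
    intro N ih
    have ih2 : (b 1 ^ N * ‖w‖) ^ 2 ≤ (b N * ‖w‖ ^ N) ^ 2 :=
      pow_le_pow_left₀ (mul_nonneg (pow_nonneg (hb0 1) N) (norm_nonneg w)) ih 2
    have h5 : (b N * ‖w‖ ^ N) ^ 2 ≤ b (2 * N) * ‖w‖ * (‖w‖ ^ N) ^ 2 := by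
      rw [mul_pow]
      exact mul_le_mul_of_nonneg_right (key1 N) (pow_nonneg (pow_nonneg (norm_nonneg w) N) 2)
    have h6 : b 1 ^ (2 * N) * ‖w‖ * ‖w‖ ≤ b (2 * N) * ‖w‖ ^ (2 * N) * ‖w‖ := by
      calc b 1 ^ (2 * N) * ‖w‖ * ‖w‖ = (b 1 ^ N * ‖w‖) ^ 2 := by ring
        _ ≤ b (2 * N) * ‖w‖ * (‖w‖ ^ N) ^ 2 := ih2.trans h5
        _ = b (2 * N) * ‖w‖ ^ (2 * N) * ‖w‖ := by ring
    exact le_of_mul_le_mul_right h6 hw0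
  -- after `k` doublings
  have iter : ∀ k : ℕ, b 1 ^ (2 ^ k) * ‖w‖ ≤ b (2 ^ k) * ‖w‖ ^ (2 ^ k) := by
    intro k
    induction k with
    | zero => simp
    | succ k ih =>
      rw [pow_succ']
      exact step _ ih
  -- squaring once more and inserting the decay hypothesis
  have final : ∀ N : ℕ, b 1 ^ N * ‖w‖ ≤ b N * ‖w‖ ^ N →
      b 1 ^ (2 * N) * ‖w‖ ^ 2 ≤ C * (r * ‖w‖) ^ (2 * N) := by
    intro N I
    have I2 : (b 1 ^ N * ‖w‖) ^ 2 ≤ (b N * ‖w‖ ^ N) ^ 2 :=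
      pow_le_pow_left₀ (mul_nonneg (pow_nonneg (hb0 1) N) (norm_nonneg w)) I 2
    calc b 1 ^ (2 * N) * ‖w‖ ^ 2 = (b 1 ^ N * ‖w‖) ^ 2 := by ring
      _ ≤ (b N * ‖w‖ ^ N) ^ 2 := I2
      _ = b N ^ 2 * (‖w‖ ^ N) ^ 2 := by ring
      _ ≤ C * r ^ (2 * N) * (‖w‖ ^ N) ^ 2 :=
          mul_le_mul_of_nonneg_right (key2 N) (pow_nonneg (pow_nonneg (norm_nonneg w) N) 2)
      _ = C * (r * ‖w‖) ^ (2 * N) := by ring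
  -- conclusion: `b 1 = ‖T w‖ ≤ r ‖w‖`, else `(b 1 / (r ‖w‖)) ^ n → ∞` contradicts `final`
  have hb1 : ‖T w‖ = b 1 := by rw [hb, pow_one]
  rw [hb1]
  refine not_lt.mp fun hlt => ?_
  have hy : 0 < r * ‖w‖ := mul_pos hr hw0
  have hs : 1 < b 1 / (r * ‖w‖) := (one_lt_div hy).mpr hlt
  have hw2 : 0 < ‖w‖ ^ 2 := pow_pos hw0 2
  obtain ⟨n₀, hn₀⟩ := Filter.eventually_atTop.mp
    ((tendsto_pow_atTop_atTop_of_one_lt hs).eventually_gt_atTop (C / ‖w‖ ^ 2))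
  have hle : n₀ ≤ 2 * 2 ^ n₀ :=
    (Nat.lt_two_pow_self (n := n₀)).le.trans (Nat.le_mul_of_pos_left (2 ^ n₀) zero_lt_two)
  have h1 := hn₀ _ hle
  have h2 := final _ (iter n₀)
  rw [div_pow, div_lt_div_iff₀ hw2 (pow_pos hy _)] at h1
  linarith

/-! ### From clustering on a dense set to the gap-norm bound -/

variable [CompleteSpace H]

/-- **Exponential clustering on a dense set of vectors forces the mass gap** (the `⇒` half of
Glimm–Jaffe 1987, §6.1 / §19.7, Thm. 19.7.1 and Remark; Osterwalder–Seiler 1978, §2; Seiler,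
LNP 159, Ch. 2): let `D` be transfer data (`T ≥ 0` a contraction, `T Ω = Ω`, `‖Ω‖ = 1`) and
`S ⊆ H` dense. If for every `v ∈ S` there is `C_v` with
`|⟪v, T^t v⟫ - ⟪v, Ω⟫⟪Ω, v⟫| ≤ C_v e^{-m t}` for all `t : ℕ`, then `‖T P_{Ω^⊥}‖ ≤ e^{-m}`.
Proof: the clustered quantity is `⟪w, T^t w⟫` for `w = P_{Ω^⊥} v` (`T` is symmetric and fixes
`Ω`), so `‖T w‖ ≤ e^{-m} ‖w‖` by the iterated Schwarz inequality
(`norm_apply_le_of_inner_pow_le`); this closed condition extends from the dense image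
`P_{Ω^⊥} S` to `Ω^⊥`, and `‖P_{Ω^⊥} x‖ ≤ ‖x‖`. [cite: GlimmJaffe1987, §6.1 Thm. 6.1.3 (iii) and §19.7 Thm. 19.7.1] -/
theorem gapNorm_le_exp_of_dense_clustering (D : TransferData H) (m : ℝ) {S : Set H}
    (hS : Dense S)
    (hcl : ∀ v ∈ S, ∃ C : ℝ, ∀ t : ℕ,
      ‖⟪v, (D.T ^ t) v⟫_ℂ - ⟪v, D.vacuum⟫_ℂ * ⟪D.vacuum, v⟫_ℂ‖ ≤ C * Real.exp (-m * t)) :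
    D.gapNorm ≤ Real.exp (-m) := by
  have hT : ∀ x y : H, ⟪D.T x, y⟫_ℂ = ⟪x, D.T y⟫_ℂ := D.isPositive.inner_left_eq_inner_right
  have hr : 0 < Real.exp (-m) := Real.exp_pos _
  -- Step 1: the bound `‖T w‖ ≤ e^{-m} ‖w‖` for `w = P_{Ω^⊥} v`, `v ∈ S`.
  have h1 : ∀ v ∈ S, ‖D.T ((D.vacuumLine)ᗮ.starProjection v)‖
      ≤ Real.exp (-m) * ‖(D.vacuumLine)ᗮ.starProjection v‖ := by
    intro v hv
    obtain ⟨C, hC⟩ := hcl v hv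
    obtain ⟨w, hw_eq⟩ : ∃ w, w = (D.vacuumLine)ᗮ.starProjection v := ⟨_, rfl⟩
    rw [← hw_eq]
    have hw : w ∈ (D.vacuumLine)ᗮ := by
      rw [hw_eq]
      exact Submodule.starProjection_apply_mem _ v
    have hdec : v = ⟪D.vacuum, v⟫_ℂ • D.vacuum + w := by
      have h := Submodule.starProjection_add_starProjection_orthogonal (K := ℂ ∙ D.vacuum) v
      rw [Submodule.starProjection_unit_singleton (𝕜 := ℂ) D.norm_vacuum v] at h
      rw [hw_eq]
      exact h.symm
    refine norm_apply_le_of_inner_pow_le hT hr (C := C) fun t => ?_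
    obtain ⟨hmem, -⟩ := D.pow_apply_mem_orthogonal_and_norm_le hw t
    have hTv : (D.T ^ t) v = ⟪D.vacuum, v⟫_ℂ • D.vacuum + (D.T ^ t) w := by
      calc (D.T ^ t) v = (D.T ^ t) (⟪D.vacuum, v⟫_ℂ • D.vacuum + w) := by rw [← hdec]
        _ = ⟪D.vacuum, v⟫_ℂ • D.vacuum + (D.T ^ t) w := by
            rw [map_add, map_smul, D.pow_apply_vacuum]
    have hP : (D.vacuumLine)ᗮ.starProjection ((D.T ^ t) w) = (D.T ^ t) w :=
      Submodule.starProjection_eq_self_iff.mpr hmem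
    have hvw : ⟪v, (D.T ^ t) w⟫_ℂ = ⟪w, (D.T ^ t) w⟫_ℂ := by
      calc ⟪v, (D.T ^ t) w⟫_ℂ = ⟪v, (D.vacuumLine)ᗮ.starProjection ((D.T ^ t) w)⟫_ℂ := by rw [hP]
        _ = ⟪(D.vacuumLine)ᗮ.starProjection v, (D.T ^ t) w⟫_ℂ :=
            (Submodule.inner_starProjection_left_eq_right _ v _).symm
        _ = ⟪w, (D.T ^ t) w⟫_ℂ := by rw [← hw_eq]
    have hkey : ⟪v, (D.T ^ t) v⟫_ℂ - ⟪v, D.vacuum⟫_ℂ * ⟪D.vacuum, v⟫_ℂ = ⟪w, (D.T ^ t) w⟫_ℂ := by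
      rw [hTv, inner_add_right, inner_smul_right, hvw]
      ring
    calc ‖⟪w, (D.T ^ t) w⟫_ℂ‖
        = ‖⟪v, (D.T ^ t) v⟫_ℂ - ⟪v, D.vacuum⟫_ℂ * ⟪D.vacuum, v⟫_ℂ‖ := by rw [hkey]
      _ ≤ C * Real.exp (-m * t) := hC t
      _ = C * Real.exp (-m) ^ t := by
          rw [← Real.exp_nat_mul]
          congr 1
          congr 1
          ring
  -- Step 2: by density of `S` and continuity, the bound holds on all of `Ω^⊥`.
  have h2 : ∀ w ∈ (D.vacuumLine)ᗮ, ‖D.T w‖ ≤ Real.exp (-m) * ‖w‖ := by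
    intro w hw
    have hclosed : IsClosed {x : H | ‖D.T x‖ ≤ Real.exp (-m) * ‖x‖} :=
      isClosed_le (continuous_norm.comp D.T.continuous) (continuous_const.mul continuous_norm)
    have hmaps : Set.MapsTo ((D.vacuumLine)ᗮ.starProjection) S
        {x : H | ‖D.T x‖ ≤ Real.exp (-m) * ‖x‖} := fun v hv => h1 v hv
    have hmem := map_mem_closure (D.vacuumLine)ᗮ.starProjection.continuous (hS w) hmaps
    rw [hclosed.closure_eq, Set.mem_setOf_eq, Submodule.starProjection_eq_self_iff.mpr hw] at hmem
    exact hmem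
  -- Step 3: `‖T P_{Ω^⊥} x‖ ≤ e^{-m} ‖P_{Ω^⊥} x‖ ≤ e^{-m} ‖x‖`.
  unfold TransferData.gapNorm
  refine ContinuousLinearMap.opNorm_le_bound _ hr.le fun x => ?_
  rw [ContinuousLinearMap.comp_apply]
  calc ‖D.T ((D.vacuumLine)ᗮ.starProjection x)‖
      ≤ Real.exp (-m) * ‖(D.vacuumLine)ᗮ.starProjection x‖ :=
        h2 _ (Submodule.starProjection_apply_mem _ x)
    _ ≤ Real.exp (-m) * ‖x‖ :=
        mul_le_mul_of_nonneg_left (Submodule.norm_starProjection_apply_le _ x) hr.le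

end IteratedSchwarz

/-! ### constructive-qft.S10, abstract form -/

section Abstract

variable {Ω : Type*} [mΩ : MeasurableSpace Ω] (μ : Measure Ω) (reflect shift : Ω → Ω)
  (mpos : MeasurableSpace Ω)
  {H : Type*} [NormedAddCommGroup H] [InnerProductSpace ℂ H] [CompleteSpace H]
  (ι : (Ω → ℂ) → H) (D : TransferData H)

/-- **Discharge of `timeClustering_iff_massGap`** (constructive-qft.S10, abstract form;
Glimm–Jaffe 1987, §6.1, Thm. 6.1.3 and §19.7, Thm. 19.7.1 with the Remark following it;
Osterwalder–Seiler 1978, §2; Seiler, LNP 159, Ch. 2): for an Osterwalder–Schrader realisation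
`(H, ι, D)` of `μ` and `m > 0`, exponential time clustering with rate `m` is equivalent to the
mass gap `‖T P_{Ω^⊥}‖ ≤ e^{-m}`. `⇐` is `IsOSRealisation.hasTimeClustering_of_hasMassGap_holds`;
`⇒` rewrites the clustered quantity for `F = G` as `⟪ι F, T^t ι F⟫ - ⟪ι F, Ω⟫⟪Ω, ι F⟫`
(`IsOSRealisation.integral_conj_comp_reflect_mul_comp_iterate`, `…integral_conj_comp_reflect`,
`…integral_eq_inner_vacuum`) and applies `gapNorm_le_exp_of_dense_clustering` to the dense
image `ι 𝓔₊^∞` (field `dense` of the realisation). [cite: GlimmJaffe1987, §6.1 Thm. 6.1.3 and §19.7 Thm. 19.7.1] -/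
theorem timeClustering_iff_massGap_holds :
    @timeClustering_iff_massGap Ω mΩ μ reflect shift mpos H _ _ _ ι D := by
  intro hOS m hm
  refine ⟨fun hcl => ⟨hm, ?_⟩, fun hgap => ?_⟩
  · refine gapNorm_le_exp_of_dense_clustering D m hOS.dense ?_
    rintro _ ⟨F, hF, rfl⟩
    obtain ⟨C, hC⟩ := hcl F F hF hF
    refine ⟨C, fun t => ?_⟩
    have h := hC t
    rwa [hOS.integral_conj_comp_reflect_mul_comp_iterate hF hF t,
      hOS.integral_conj_comp_reflect hF, hOS.integral_eq_inner_vacuum hF] at h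
  · exact IsOSRealisation.hasTimeClustering_of_hasMassGap_holds hOS hgap

end Abstract

/-! ### constructive-qft.S10, lattice form on `ℤ^d` -/

section Lattice

variable {d : ℕ} [NeZero d] {S : Type*} [MeasurableSpace S]
  {H : Type*} [NormedAddCommGroup H] [InnerProductSpace ℂ H] [CompleteSpace H]

/-- **Discharge of `latticeClustering_iff_gap`** (constructive-qft.S10, lattice form;
Osterwalder–Seiler 1978, §2; Seiler, LNP 159, Ch. 2; Glimm–Jaffe 1987, §6.1 and §19.7): for a
probability measure on configurations `ℤ^d → S` whose Osterwalder–Schrader reconstruction with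
respect to the time reflection between sites `latticeTimeReflection d`, the unit time shift
`latticeTimeShift d S` and the positive-time σ-algebra `positiveTimeEvents d S` is realised by
`(H, ι, D)`, exponential clustering in the time direction with rate `m > 0` is equivalent to the
mass gap `‖T P_{Ω^⊥}‖ ≤ e^{-m}` of the transfer operator. This is the abstract statement
`timeClustering_iff_massGap_holds` applied to the lattice data (restoring the interim proof
recorded in `LatticeMassGap.lean`). [cite: OsterwalderSeiler1978, §2] -/
theorem latticeClustering_iff_gap_holds :
    latticeClustering_iff_gap (d := d) (S := S) (H := H) := by
  intro μ _ ι D hOS m hm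
  exact timeClustering_iff_massGap_holds μ _ _ _ ι D hOS m hm

end Lattice

end Literature.MathematicalPhysics.QuantumFieldTheory
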